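import Summits.PneNP.PneNP.Theorems.SzkEntropyPeaWorstToAvgOrbitPairRsrDefs
import Summits.PneNP.PneNP.Theorems.SzkEntropyPeaWorstToAvgDualModeCompileDefs
import Summits.PneNP.PneNP.Theorems.SzkEntropyPeaWorstToAvgDualModeCompileDecider
import Literature.Computability.Complexity.PromiseBPPFromFPDecider
import Literature.Computability.Complexity.UniformProbBlocks
import Literature.Computability.Complexity.PolynomialEntropyApproximationDegOne
import Literature.Computability.MetaComplexity.SchemeEncBricks
import HarnessLib

/-!
# Route SzkEntropy, crux `PeaWorstToAvg` (stmt-PneNP-10777), line `orbit-pair-rsr`: the orbit random self-reduction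

Stub `stub_orbitRSR` of the skeleton `Summits/PneNP/PneNP/Cruxes/PeaWorstToAvg/Lines/orbit-pair-rsr.lean`
(objects: `Theorems/SzkEntropyPeaWorstToAvgOrbitPairRsrDefs.lean`).  A UNIFORM randomized heuristic scheme
`U(y, 1ⁿ, 1ᵐ)` (`UHeurBPP`: honest polynomial coin budget `c_U`) for the distributional problem
`(OrbitPair.yes, ½ law_false + ½ law_true)` of an orbit kit (the fair mixture of the planted laws of the two
orbits), together with the kit's in-orbit re-randomiser `rer` (`1/16`-close to the planted law of the orbit slice
of its input), decides the orbit-pair promise problem in textbook promise-`BPP` (`PromiseBPP'`, Goldreich 2006,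
Def. 1.2) — the worst case is decided through the random self-reduction (Feigenbaum–Fortnow 1993).

The machine (a total one-bit `FP` string function on words `⟨x, y⟩`, assembled from the tree's bricks inside
`orbitRSR_exists_machine`): parse the size field `s` of the instance (first pair component, a binary numeral) and
form `1ⁿ`, `n = min(s, |x|) - 1` (`binToUnaryFn`, `List.tail`; on the promise `s ≤ |x|`, `s ≥ 1`, so `n + 1 = s`,
`orbitRSR_size_eq`); read the first `rerCoins(|x|)` coins `r₁` of `y`, compute `z = rer(x; r₁)`, form the query
`q = ⟨z, 1ⁿ, 1^{256}⟩`, read the next `c_U(|q|)` coins `r₂` (computable because the budget of a UNIFORM scheme is a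
polynomial — the only use of uniformity) and output `U(q; r₂)`.  ONE run suffices (`orbitRSR_fail_le`): on a YES
instance `x` of size `s = n + 1` the inputs `z` on which `U` errs with probability `≥ 1/4` have mixture-mass
`≤ 1/256` at parameter `n`, hence `law_true n`-mass `≤ 1/128`; adding the off-support strings (mass `0`) and
transporting along `rer_close`, the draw `z ← rer x` is bad with probability `≤ 1/128 + 1/16 = 9/128`; a good `z`
lies in `supp (law_true n) ⊆ OrbitPair.yes` (`OrbitKit.law_true_support`), so `U` answers `true` except with
probability `< 1/4` over ITS fresh coins (`uniformProb_block_le`).  Failure `≤ 9/128 + 1/4 = 41/128`, success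
`≥ 87/128 ≥ 2/3`; NO instances symmetrically (`OrbitKit.law_false_support`, disjointness).  The coin polynomial
is `rerCoins + c_U ∘ G` with `G` a polynomial bound of `|q|` (output-length bound of the re-randomiser's machine,
`n ≤ |x|`).  The file follows `SzkEntropyPeaWorstToAvgDualModeCompileDecider.lean` (line `dual-mode-compile`,
whose two machine-packaging lemmas `decider_runPair_mem_FP`, `decider_runScheme_mem_FP` are reused); no
definitions are introduced (the machine is a local term).

References: O. Goldreich, *On promise problems: a survey*, LNCS 3895 (2006), Def. 1.2; S. Arora, B. Barak,
*Computational Complexity* (2009), Def. 7.3, §7.4.1; A. Bogdanov, L. Trevisan, *Average-Case Complexity*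
(2006), Def. 2.12–2.13; J. Feigenbaum, L. Fortnow, *Random-self-reducibility of complete sets*, SIAM J.
Comput. 22 (1993); J. Patarin, EUROCRYPT 1996 (isomorphism of polynomials: the orbits).
-/

noncomputable section

open _root_.Computability
open Literature.Computability.Complexity Literature.Computability.MetaComplexity
open Literature.Computability.Complexity.Brick
open Summit.PneNP.PneNP.Theorems

namespace Summit.PneNP.PneNP.Cruxes.PeaWorstToAvg.OrbitPairRsr

set_option linter.dupNamespace false -- `Summit.PneNP.PneNP.…`: summit = sub-problem name (D-0017)

open Summit.PneNP.PneNP.Cruxes.PeaWorstToAvg.DualModeCompile (UHeurBPP decider_runPair_mem_FP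
  decider_runScheme_mem_FP)

/-! ### Acceptance probabilities of one run -/

section Probability

variable {p₀ p₁ : (s : ℕ) → PolyMapF2 s} {k : ℕ → ℕ} {kit : OrbitKit p₀ p₁ k}
  {U : RandAlg (List Bool × ℕ × ℕ) Bool} {cU : Polynomial ℕ}

/-- Monotonicity of `uniformProb m` along inclusions checked on strings of length `m` only. [folklore] -/
private theorem uniformProb_mono_len {m : ℕ} {E E' : Set (List Bool)}
    (h : ∀ y : List Bool, y.length = m → y ∈ E → y ∈ E') : uniformProb m E ≤ uniformProb m E' := by
  classical
  unfold uniformProb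
  refine div_le_div_of_nonneg_right ?_ (by positivity)
  exact_mod_cast Finset.card_le_card fun r hr => by
    simp only [Finset.mem_filter, Finset.mem_univ, true_and] at hr ⊢
    exact h _ r.toList_length hr

/-- **Few bad draws.** If a set `Bad` has mixture-mass `≤ 1/256` at parameter `n` and the law of `rer w` is
`1/16`-close to the planted law of side `b` at `n`, then `rer w` falls outside `G = supp (law_b n) ∖ Bad` with
probability `≤ 2/256 + 1/16 = 9/128` (`toOuterMeasure_le_two_mul_mixEnsemble`; off-support strings have mass `0`).
[cite: BogdanovTrevisan2006, Def. 2.12] -/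
theorem orbitRSR_pr_compl_good_le (b : Bool) (n : ℕ) (w : List Bool) (Bad : Set (List Bool))
    (hbad : kit.mix.prob n Bad ≤ 1 / 256)
    (hrer : ∀ E : Set (List Bool), kit.rer.pr id w E ≤ (kit.samp b).pr unaryEncodeNat n E + 1 / 16) :
    kit.rer.pr id w {z | z ∈ (kit.law b n).support ∧ z ∉ Bad}ᶜ ≤ 9 / 128 := by
  set G : Set (List Bool) := {z | z ∈ (kit.law b n).support ∧ z ∉ Bad} with hGdef
  refine (hrer Gᶜ).trans ?_
  have hsub : Gᶜ ∩ (kit.law b n).support ⊆ Bad := by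
    rintro z ⟨hz, hsupp⟩
    by_contra hzb
    exact hz ⟨hsupp, hzb⟩
  have hle : (kit.law b n).toOuterMeasure Gᶜ ≤
      2 * (mixEnsemble (kit.law false) (kit.law true) n).toOuterMeasure Bad := by
    refine (PMF.toOuterMeasure_mono _ hsub).trans ?_
    have h2 := toOuterMeasure_le_two_mul_mixEnsemble (kit.law false) (kit.law true) n Bad b
    cases b <;> simpa using h2
  have hR : ((kit.law b n).toOuterMeasure Gᶜ).toReal ≤
      2 * ((mixEnsemble (kit.law false) (kit.law true) n).toOuterMeasure Bad).toReal := by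
    have := ENNReal.toReal_mono (ENNReal.mul_ne_top (by simp) (toOuterMeasure_ne_top' _ _)) hle
    rwa [ENNReal.toReal_mul, ENNReal.toReal_ofNat] at this
  have hpr : (kit.samp b).pr unaryEncodeNat n Gᶜ = ((kit.law b n).toOuterMeasure Gᶜ).toReal := rfl
  have hmix : ((mixEnsemble (kit.law false) (kit.law true) n).toOuterMeasure Bad).toReal ≤ 1 / 256 := hbad
  rw [hpr]
  linarith

/-- **Failure probability of one run** (side `b`, orbit point `w`, parameter `n`, coins `rerCoins(|w|) + m` with
`m` at least every reachable budget `c_U(|query|)`): the output bit `U(⟨z, 1ⁿ, 1^{256}⟩; r₂)`, `z = rer(w; r₁)`,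
differs from `b` with probability `≤ 41/128` — the draw `z` is bad with probability `≤ 9/128`
(`orbitRSR_pr_compl_good_le`, read off the prefix `r₁`, `uniformProb_take_of_le`), and for a good `z` (so
`[z ∈ Y] = b` and coin error `< 1/4`) the fresh block `r₂` errs with probability `< 1/4` (`uniformProb_block_le`);
union bound. [cite: Goldreich2006, Def. 1.2] [cite: AroraBarak2009, §7.4.1] -/
theorem orbitRSR_fail_le (hcU : ∀ ℓ, U.coinLen ℓ = cU.eval ℓ) (Y : Language Bool) (b : Bool) (n : ℕ)
    (w : List Bool)
    (hbad : kit.mix.prob n {z | 1 / 4 ≤ U.pr schemeEnc (z, n, 256) {c | c ≠ Y.boolIndicator z}} ≤ 1 / 256)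
    (hmode : ∀ z ∈ (kit.law b n).support, Y.boolIndicator z = b)
    (hrer : ∀ E : Set (List Bool), kit.rer.pr id w E ≤ (kit.samp b).pr unaryEncodeNat n E + 1 / 16)
    {m : ℕ} (hm : ∀ r : List Bool, r.length = kit.rerCoins.eval w.length →
      cU.eval (schemeEnc (kit.rer.run w r, n, 256)).length ≤ m) :
    uniformProb (kit.rerCoins.eval w.length + m)
      {y | U.run (kit.rer.run w (y.take (kit.rerCoins.eval w.length)), n, 256)
        ((y.drop (kit.rerCoins.eval w.length)).take (cU.eval
          (schemeEnc (kit.rer.run w (y.take (kit.rerCoins.eval w.length)), n, 256)).length)) ≠ b} ≤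
      41 / 128 := by
  -- notation
  set a := kit.rerCoins.eval w.length with ha
  set Bad : Set (List Bool) :=
    {z | 1 / 4 ≤ U.pr schemeEnc (z, n, 256) {c | c ≠ Y.boolIndicator z}} with hBad
  set G : Set (List Bool) := {z | z ∈ (kit.law b n).support ∧ z ∉ Bad} with hGdef
  set ℓ : List Bool → ℕ := fun r => cU.eval (schemeEnc (kit.rer.run w r, n, 256)).length with hℓ
  -- the two failure events: a bad draw; a good draw but erring fresh coins
  set F₁ : Set (List Bool) := {y | y.take a ∈ {r : List Bool | kit.rer.run w r ∈ Gᶜ}} with hF₁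
  set B : List Bool → Set (List Bool) := fun r =>
    {u | kit.rer.run w r ∈ G ∧ U.run (kit.rer.run w r, n, 256) (u.take (ℓ r)) ≠ b} with hB
  set F₂ : Set (List Bool) := {y | (y.drop a).take m ∈ B (y.take a)} with hF₂
  -- a bad draw
  have h1 : uniformProb (a + m) F₁ ≤ 9 / 128 := by
    rw [hF₁, uniformProb_take_of_le (Nat.le_add_right a m)]
    have hpr : kit.rer.pr id w Gᶜ = uniformProb a {r : List Bool | kit.rer.run w r ∈ Gᶜ} := by
      rw [RandAlg.pr_eq_uniformProb]
      change uniformProb (kit.rer.coinLen w.length) _ = _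
      rw [kit.rer_coinLen]
    rw [← hpr]
    exact orbitRSR_pr_compl_good_le b n w Bad hbad hrer
  -- erring fresh coins after a good draw
  have h2 : uniformProb (a + m) F₂ ≤ 1 / 4 := by
    have hblk := uniformProb_block_le (a := a) (ℓ := m) (d := 0) B (δ := 1 / 4) fun r hr => ?_
    · have e0 : a + m + 0 = a + m := rfl
      rw [e0] at hblk
      exact hblk
    by_cases hz : kit.rer.run w r ∈ G
    · have hind : Y.boolIndicator (kit.rer.run w r) = b := hmode _ hz.1
      have hgood : U.pr schemeEnc (kit.rer.run w r, n, 256) {c | c ≠ b} < 1 / 4 := by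
        have hnb := hz.2
        simp only [hBad, Set.mem_setOf_eq, not_le, hind] at hnb
        exact hnb
      rw [RandAlg.pr_eq_uniformProb, hcU] at hgood
      have hBw : B r = {u | u.take (ℓ r) ∈
          {r' : List Bool | U.run (kit.rer.run w r, n, 256) r' ∈ {c : Bool | c ≠ b}}} :=
        Set.ext fun u => ⟨fun hu => hu.2, fun hu => ⟨hz, hu⟩⟩
      rw [hBw, uniformProb_take_of_le (hm r hr)]
      exact hgood.le
    · have hBw : B r = ∅ := Set.ext fun u => ⟨fun hu => hz hu.1, fun hu => hu.elim⟩
      rw [hBw, uniformProb_empty]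
      norm_num
  -- every failing coin string is of one of the two kinds
  refine (uniformProb_mono_len (E' := F₁ ∪ F₂) fun y hy hfail => ?_).trans ?_
  · by_cases hz : kit.rer.run w (y.take a) ∈ G
    · refine Or.inr ?_
      have hdrop : (y.drop a).take m = y.drop a :=
        List.take_of_length_le (by rw [List.length_drop, hy]; omega)
      change (y.drop a).take m ∈ B (y.take a)
      rw [hdrop]
      exact ⟨hz, hfail⟩
    · exact Or.inl hz
  calc uniformProb (a + m) (F₁ ∪ F₂)
      ≤ uniformProb (a + m) F₁ + uniformProb (a + m) F₂ := uniformProb_union_le _ _ _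
    _ ≤ 9 / 128 + 1 / 4 := add_le_add h1 h2
    _ = 41 / 128 := by norm_num

/-- **Success probability of one run**: the output bit equals the side `b` with probability
`≥ 1 - 41/128 = 87/128 ≥ 2/3`. [cite: Goldreich2006, Def. 1.2] -/
theorem orbitRSR_success (hcU : ∀ ℓ, U.coinLen ℓ = cU.eval ℓ) (Y : Language Bool) (b : Bool) (n : ℕ)
    (w : List Bool)
    (hbad : kit.mix.prob n {z | 1 / 4 ≤ U.pr schemeEnc (z, n, 256) {c | c ≠ Y.boolIndicator z}} ≤ 1 / 256)
    (hmode : ∀ z ∈ (kit.law b n).support, Y.boolIndicator z = b)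
    (hrer : ∀ E : Set (List Bool), kit.rer.pr id w E ≤ (kit.samp b).pr unaryEncodeNat n E + 1 / 16)
    {m : ℕ} (hm : ∀ r : List Bool, r.length = kit.rerCoins.eval w.length →
      cU.eval (schemeEnc (kit.rer.run w r, n, 256)).length ≤ m) :
    (2 / 3 : ℝ) ≤ uniformProb (kit.rerCoins.eval w.length + m)
      {y | U.run (kit.rer.run w (y.take (kit.rerCoins.eval w.length)), n, 256)
        ((y.drop (kit.rerCoins.eval w.length)).take (cU.eval
          (schemeEnc (kit.rer.run w (y.take (kit.rerCoins.eval w.length)), n, 256)).length)) = b} := by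
  have hfail := orbitRSR_fail_le hcU Y b n w hbad hmode hrer hm
  have hc : {y : List Bool | U.run (kit.rer.run w (y.take (kit.rerCoins.eval w.length)), n, 256)
        ((y.drop (kit.rerCoins.eval w.length)).take (cU.eval
          (schemeEnc (kit.rer.run w (y.take (kit.rerCoins.eval w.length)), n, 256)).length)) = b} =
      {y : List Bool | U.run (kit.rer.run w (y.take (kit.rerCoins.eval w.length)), n, 256)
        ((y.drop (kit.rerCoins.eval w.length)).take (cU.eval
          (schemeEnc (kit.rer.run w (y.take (kit.rerCoins.eval w.length)), n, 256)).length)) ≠ b}ᶜ := by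
    ext y
    simp
  rw [hc, uniformProb_compl]
  linarith

end Probability

/-! ### The machine -/

/-- **The decider as a one-bit `FP` function.** For a probabilistic polynomial-time string map `R` with a
polynomial `c_R`, a polynomial-time scheme `U`, a polynomial `c_U` and a constant `t` there is a total one-bit `FP`
string function whose value on `⟨x, y⟩` is `[U(⟨z, 1ⁿ, 1ᵗ⟩; r₂)]` with `n = min(⟦⟨x⟩₁⟧, |x|) - 1` (the size
field of `x`, a binary numeral, capped by `|x|` and decremented: `binToUnaryFn`, `List.tail`),
`r₁ = y ↾ c_R(|x|)`, `z = R(x; r₁)`, `r₂ = (y ⇂ c_R(|x|)) ↾ c_U(|⟨z, 1ⁿ, 1ᵗ⟩|)` (bricks `fanoutFn`, `fstF/sndF`,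
`Plumb.takeFn/dropFn/polyFn`, the two machines). [cite: AroraBarak2009, §1.3] [cite: Goldreich2006, Def. 1.2] -/
theorem orbitRSR_exists_machine {R : RandAlg (List Bool) (List Bool)}
    (hR : R.IsPolyTime (id : List Bool → List Bool) (id : List Bool → List Bool)) (cR : Polynomial ℕ)
    {U : RandAlg (List Bool × ℕ × ℕ) Bool} (hU : U.IsPolyTime schemeEnc encodeBool) (cU : Polynomial ℕ)
    (t : ℕ) :
    ∃ dec : List Bool → List Bool, dec ∈ FP ∧ OneBit dec ∧ ∀ x y : List Bool,
      dec (boolPair x y) =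
        [U.run (R.run x (y.take (cR.eval x.length)), min (bitsToNat (fstF x)) x.length - 1, t)
          ((y.drop (cR.eval x.length)).take (cU.eval (schemeEnc
            (R.run x (y.take (cR.eval x.length)), min (bitsToNat (fstF x)) x.length - 1, t)).length))] := by
  -- the stages of the machine, as total string functions
  set peF : List Bool → List Bool := Plumb.polyFn cR ∘ fstF with hpeF
  set r1F : List Bool → List Bool := Plumb.takeFn ∘ fanoutFn peF sndF with hr1F
  set zF : List Bool → List Bool := (fun w => R.run (fstF w) (sndF w)) ∘ fanoutFn fstF r1F with hzF
  set nF : List Bool → List Bool := List.tail ∘ binToUnaryFn ∘ fanoutFn fstF (fstF ∘ fstF) with hnF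
  set qF : List Bool → List Bool := fanoutFn zF (fanoutFn nF fun _ => unaryEncodeNat t) with hqF
  set r2F : List Bool → List Bool :=
    Plumb.takeFn ∘ fanoutFn (Plumb.polyFn cU ∘ qF) (Plumb.dropFn ∘ fanoutFn peF sndF) with hr2F
  set dec : List Bool → List Bool :=
    (fun w => encodeBool (U.run (decScheme (fstF w)) (sndF w))) ∘ fanoutFn qF r2F with hdec
  refine ⟨dec, ?_, fun _ => ⟨_, rfl⟩, fun x y => ?_⟩
  · -- closure of `FP` under composition and fan-out
    have hpe : peF ∈ FP := comp_mem_FP (Plumb.polyFn_mem_FP _) fstF_mem_FP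
    have hr1 : r1F ∈ FP := comp_mem_FP Plumb.takeFn_mem_FP (fanoutFn_mem_FP hpe sndF_mem_FP)
    have hz : zF ∈ FP := comp_mem_FP (decider_runPair_mem_FP hR) (fanoutFn_mem_FP fstF_mem_FP hr1)
    have hn : nF ∈ FP :=
      comp_mem_FP PRelSigma.tail_mem_FP (comp_mem_FP binToUnaryFn_mem_FP
        (fanoutFn_mem_FP fstF_mem_FP (comp_mem_FP fstF_mem_FP fstF_mem_FP)))
    have hq : qF ∈ FP := fanoutFn_mem_FP hz (fanoutFn_mem_FP hn (const_mem_FP _))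
    have hr2 : r2F ∈ FP :=
      comp_mem_FP Plumb.takeFn_mem_FP (fanoutFn_mem_FP (comp_mem_FP (Plumb.polyFn_mem_FP cU) hq)
        (comp_mem_FP Plumb.dropFn_mem_FP (fanoutFn_mem_FP hpe sndF_mem_FP)))
    exact comp_mem_FP (decider_runScheme_mem_FP hU) (fanoutFn_mem_FP hq hr2)
  · -- the value on a pair
    have hpe : peF (boolPair x y) = ones (cR.eval x.length) := by
      simp only [hpeF, Function.comp_apply, fstF_boolPair, Plumb.polyFn_apply]
    have hr1 : r1F (boolPair x y) = y.take (cR.eval x.length) := by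
      simp only [hr1F, Function.comp_apply, fanoutFn_apply, hpe, sndF_boolPair, Plumb.takeFn_boolPair,
        List.length_replicate]
    have hz : zF (boolPair x y) = R.run x (y.take (cR.eval x.length)) := by
      simp only [hzF, Function.comp_apply, fanoutFn_apply, fstF_boolPair, sndF_boolPair, hr1]
    have hn : nF (boolPair x y) = unaryEncodeNat (min (bitsToNat (fstF x)) x.length - 1) := by
      simp only [hnF, Function.comp_apply, fanoutFn_apply, fstF_boolPair, binToUnaryFn_boolPair]
      rw [OracleCompose.unaryEncodeNat_eq_replicate, List.tail_replicate]
    have hq : qF (boolPair x y) =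
        schemeEnc (R.run x (y.take (cR.eval x.length)), min (bitsToNat (fstF x)) x.length - 1, t) := by
      simp only [hqF, fanoutFn_apply, hz, hn]
      rfl
    have hr2 : r2F (boolPair x y) = (y.drop (cR.eval x.length)).take (cU.eval (schemeEnc
        (R.run x (y.take (cR.eval x.length)), min (bitsToNat (fstF x)) x.length - 1, t)).length) := by
      simp only [hr2F, Function.comp_apply, fanoutFn_apply, hq, hpe, sndF_boolPair, Plumb.takeFn_boolPair,
        Plumb.dropFn_boolPair, Plumb.polyFn_apply, List.length_replicate]
    simp only [hdec, Function.comp_apply, fanoutFn_apply, fstF_boolPair, sndF_boolPair, hq, hr2,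
      decScheme_schemeEnc]
    rfl

/-! ### Parsing the size of an orbit instance -/

section Parse

variable {p₀ p₁ : (s : ℕ) → PolyMapF2 s} {k : ℕ → ℕ}

/-- Affinely equivalent maps have the same number of output polynomials (`m = |P|` is the format of
`affOut`). [cite: Patarin1996, §2 (IP with two secrets)] -/
theorem AffEquiv.length_eq {s : ℕ} {P Q : PolyMapF2 s} (h : AffEquiv P Q) : Q.length = P.length := by
  obtain ⟨A, b, B, c, -, -, hQ⟩ := h
  have h0 := congrArg List.length (hQ 0)
  rwa [PolyMapF2.length_eval, affOut, List.length_ofFn] at h0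

/-- **Parsing the size.** On a string `x` of the size-`s` slice of the orbit of a family with `s ≤ |pˢ|`, the
parsed parameter `n = min(⟦⟨x⟩₁⟧, |x|) - 1` satisfies `n + 1 = s`: `x = ⟨bin s, ⟨code q, bin j⟩⟩` with `s ≥ 1` and
`|x| ≥ |q| = |pˢ| ≥ s` (the list code of `q` carries the unary header `1^{|q|}`; `PEAInst.encode_eq_untypedCode`).
[cite: AroraBarak2009, §0.1] -/
theorem orbitRSR_size_eq {p : (s : ℕ) → PolyMapF2 s} {s : ℕ} (hs : s ≤ (p s).length) {x : List Bool}
    (hx : x ∈ Side p k s) : min (bitsToNat (fstF x)) x.length - 1 + 1 = s := by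
  obtain ⟨I, ⟨hI, hIs⟩, rfl⟩ := hx
  obtain ⟨s', q, j⟩ := I
  obtain ⟨hs1, -, -, hAff⟩ := hI
  dsimp only at hIs hs1 hAff
  subst hIs
  have hcode := PEAInst.encode_eq_untypedCode ⟨s', q, j⟩
  simp only [PEAInst.untypedCode, PEAInst.untyped, CodeFP.pairE_apply, CodeFP.listE] at hcode
  have hql : q.length = (p s').length := hAff.length_eq
  have hxlen : s' ≤ (PEAInst.encoding.encode (⟨s', q, j⟩ : PEAInst)).length := by
    rw [hcode]
    simp only [length_boolPair, CodeFP.length_unE, List.length_map]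
    omega
  rw [hcode, fstF_boolPair, CodeFP.bitsToNat_natE, ← hcode, Nat.min_eq_left hxlen]
  omega

/-- A YES instance of the orbit pair lies in some size slice of the `p₁`-orbit. [folklore] -/
theorem exists_side_of_mem_yes {x : List Bool} (hx : x ∈ (OrbitPair p₀ p₁ k).yes) : ∃ s, x ∈ Side p₁ k s := by
  obtain ⟨I, hI, rfl⟩ := hx
  exact ⟨I.1, I, ⟨hI, rfl⟩, rfl⟩

/-- A NO instance of the orbit pair lies in some size slice of the `p₀`-orbit. [folklore] -/
theorem exists_side_of_mem_no {x : List Bool} (hx : x ∈ (OrbitPair p₀ p₁ k).no) : ∃ s, x ∈ Side p₀ k s := by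
  obtain ⟨I, hI, rfl⟩ := hx
  exact ⟨I.1, I, ⟨hI, rfl⟩, rfl⟩

end Parse

/-! ### The stub -/

/-- **STUB · `stub_orbitRSR`** (the orbit random self-reduction).  A uniform heuristic scheme `U` for
`(OrbitPair.yes, ½ law_false + ½ law_true)` (the kit's planted laws) decides `OrbitPair p₀ p₁ k` in textbook
`PromiseBPP'`: on `x`, parse its size `s` and set `n = s - 1` (`orbitRSR_size_eq`, using `s ≤ |p_bˢ|`), draw
`z ← rer x` (first `rerCoins(|x|)` coins), run `U(z, 1ⁿ, 1^{256})` on the next `c_U(|⟨z, 1ⁿ, 1^{256}⟩|)` coins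
(computable: the budget of a UNIFORM scheme is a polynomial), output its bit.  On a YES instance (`x` in the
size-`(n+1)` slice of the `p₁`-orbit) the bad set of `U` at parameter `n` has mixture-mass `≤ 1/256`, hence
`law_true n`-mass `≤ 1/128`; off-support strings have mass `0`; by `rer_close` the draw avoids both except with
probability `≤ 1/128 + 1/16`, and then `z ∈ OrbitPair.yes` (`OrbitKit.law_true_support`) so `U` answers `true` with
probability `> 3/4`: success `≥ 87/128 ≥ 2/3`; symmetrically on NO instances (`rer_close` on the `p₀`-slice,
`OrbitKit.law_false_support`, disjointness).  The coin polynomial is `rerCoins + c_U ∘ G`, `G` a polynomial bound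
of the query length, and the predicate `(x, coins) ↦ answer` is a one-bit `FP` function
(`orbitRSR_exists_machine`, `PromiseProblem.mem_PromiseBPP'_of_fp_decider`). [cite: Goldreich2006, Def. 1.2]
[cite: FeigenbaumFortnow1993, §1 (random self-reductions)] [cite: BogdanovTrevisan2006, Def. 2.12–2.13] -/
theorem stub_orbitRSR (p₀ p₁ : (s : ℕ) → PolyMapF2 s) (k : ℕ → ℕ) (kit : OrbitKit p₀ p₁ k)
    (hlen : ∀ s, s ≤ (p₀ s).length ∧ s ≤ (p₁ s).length) (hdisj : (OrbitPair p₀ p₁ k).Disjoint)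
    (h : (⟨(OrbitPair p₀ p₁ k).yes, kit.mix⟩ : DistProblem) ∈ UHeurBPP) : OrbitPair p₀ p₁ k ∈ PromiseBPP' := by
  obtain ⟨U, hU, ⟨cU, hcU⟩, hbad⟩ := h
  obtain ⟨dec, hdec, h1, hval⟩ := orbitRSR_exists_machine kit.rer_polyTime kit.rerCoins hU cU 256
  -- a polynomial bound `G(|x|)` of the query length `|⟨z, 1ⁿ, 1^{256}⟩|` over all reachable `z` and `n ≤ |x|`
  obtain ⟨s, hs⟩ := exists_poly_length_le_of_mem_FP (decider_runPair_mem_FP kit.rer_polyTime)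
  set G : Polynomial ℕ :=
    2 * s.comp (2 * Polynomial.X + 2 + kit.rerCoins) + 2 * Polynomial.X + 260 with hGdef
  have hG : ∀ (x : List Bool) (n : ℕ), n ≤ x.length → ∀ r : List Bool, r.length = kit.rerCoins.eval x.length →
      cU.eval (schemeEnc (kit.rer.run x r, n, 256)).length ≤ cU.eval (G.eval x.length) := by
    intro x n hn r hr
    refine TM2Iter.eval_mono cU ?_
    have hzr := hs (boolPair x r)
    simp only [fstF_boolPair, sndF_boolPair, length_boolPair, hr] at hzr
    have hGe : G.eval x.length =
        2 * s.eval (2 * x.length + 2 + kit.rerCoins.eval x.length) + 2 * x.length + 260 := by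
      simp only [hGdef, Polynomial.eval_add, Polynomial.eval_mul, Polynomial.eval_comp, Polynomial.eval_X,
        Polynomial.eval_ofNat]
    rw [length_schemeEnc, hGe]
    omega
  -- the bad sets of `U` at failure parameter `1/256`
  have hbad' : ∀ n : ℕ, kit.mix.prob n
      {z | 1 / 4 ≤ U.pr schemeEnc (z, n, 256) {c | c ≠ (OrbitPair p₀ p₁ k).yes.boolIndicator z}} ≤ 1 / 256 := by
    intro n
    have h256 := hbad n 256 (by norm_num)
    have e : (1 : ℝ) / ((256 : ℕ) : ℝ) = 1 / 256 := by norm_num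
    rw [e] at h256
    exact h256
  have hnle : ∀ x : List Bool, min (bitsToNat (fstF x)) x.length - 1 ≤ x.length := fun x =>
    (Nat.sub_le _ _).trans (Nat.min_le_right _ _)
  refine PromiseProblem.mem_PromiseBPP'_of_fp_decider (OrbitPair p₀ p₁ k) hdec h1 (kit.rerCoins + cU.comp G)
    (fun x hx => ?_) (fun x hx => ?_)
  · obtain ⟨sz, hside⟩ := exists_side_of_mem_yes hx
    rw [← orbitRSR_size_eq (hlen sz).2 hside] at hside
    simp only [hval, List.cons.injEq, and_true, Polynomial.eval_add, Polynomial.eval_comp]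
    exact orbitRSR_success hcU _ true _ x (hbad' _)
      (fun z hz => (Set.mem_iff_boolIndicator _ _).1 (kit.law_true_support _ z hz))
      (kit.rer_close true _ x hside) (hG x _ (hnle x))
  · obtain ⟨sz, hside⟩ := exists_side_of_mem_no hx
    rw [← orbitRSR_size_eq (hlen sz).1 hside] at hside
    simp only [hval, List.cons.injEq, and_true, Polynomial.eval_add, Polynomial.eval_comp]
    exact orbitRSR_success hcU _ false _ x (hbad' _)
      (fun z hz => (Set.notMem_iff_boolIndicator _ _).1
        (fun hy => Set.disjoint_left.1 hdisj hy (kit.law_false_support _ z hz)))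
      (kit.rer_close false _ x hside) (hG x _ (hnle x))

end Summit.PneNP.PneNP.Cruxes.PeaWorstToAvg.OrbitPairRsr

end
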